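import Mathlib.Analysis.Complex.Basic
import Mathlib.Analysis.SpecialFunctions.Trigonometric.Basic
import Mathlib.LinearAlgebra.Eigenspace.Basic
import Mathlib.LinearAlgebra.Dual.Defs
import HarnessLib

/-!
# Koo–Saleur lattice Virasoro generators and scaling-weak convergence

Koo–Saleur (Nucl. Phys. B 426 (1994) 459 = hep-th/9312156, §3) proposed lattice analogues of the
Virasoro generators, built from the local densities of a critical quantum chain, and conjectured that
their restrictions to low-energy ("scaling") states represent `P Vir P` in the continuum limit. In
the Temperley–Lieb / loop-model setting the generators are printed as
(Grans-Samuelsson–Liu–He–Jacobsen–Saleur 2020, eq. (generators), with periodic indices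
`e_{N+1} = e₁`, `q = e^{iγ}`, bulk energy density `e_∞`, central charge `c`):

  `ℒₙ[N] = (N/4π) [ -(γ/(π sin γ)) Σ_{j=1}^{N} e^{2πinj/N} ( eⱼ - e_∞ + (iγ/(π sin γ)) [eⱼ, e_{j+1}] ) ] + (c/24) δ_{n,0}`,
  `ℒ̄ₙ[N] = (N/4π) [ -(γ/(π sin γ)) Σ_{j=1}^{N} e^{-2πinj/N} ( eⱼ - e_∞ - (iγ/(π sin γ)) [eⱼ, e_{j+1}] ) ] + (c/24) δ_{n,0}`

("which were first derived via other means in [KooSaleur]"). The nature of the convergence is the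
**scaling-weak convergence** of Grans-Samuelsson–Jacobsen–Saleur 2021, §7.1: "1) matrix elements of
lattice Virasoro generators converge, when evaluated between scaling states, to their expected
continuum limit and 2) matrix elements of products […] converge […] when the products are calculated
using only such intermediate states which are scaling states, and using a double-limit procedure
[…] we shall refer to the above phenomenon as scaling-weak convergence"; in the 2020 paper, App. 10.1
(generic_swc): `lim_{N→∞} ‖Π^{(d)} 𝒵[N]‖ = 0 ∀ d`, `Π^{(d)}` the projector on the lowest `d` states.

## What is defined (interface posited for route `CriticalPhenomena/SAWLatticeVirasoro`, item
`KooSaleurVirasoro`; statement 1) of GSJS in a BASIS-FREE, INNER-PRODUCT-FREE form, so that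
non-unitary / indecomposable limits, `c = 0`, are allowed)

* `kooSaleurGen γ eInf c e n`, `kooSaleurGenBar γ eInf c e n` — the printed periodic generators for a
  family `e : Fin N → End V` (index `j + 1` modulo `N`);
* `latticeMode w A B` — the generic Fourier-mode combination `Σⱼ (wⱼ • Aⱼ + w'ⱼ • Bⱼ)` from which
  open-chain variants (cosine/sine weights, densities `hⱼ - e_∞` and `i[hⱼ, h_{j+1}]`) are built by
  consumers;
* `compress π A` — `P A P` restricted to a subspace `S` with a chosen retraction `π : V → S`;
* `scalingWindow H Λ` — the sum of the generalised eigenspaces of `H` with `Re μ ≤ Λ` (the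
  low-energy "scaling states" below a scaled gap), `IsRetractionOnto`, `CommutesWith`;
* `ConvergesScalingWeaklyAt V l S W T N` — AT CUTOFF `N`: eventually in `L` there are linear
  identifications `ι_L : S_L ≃ W` of the chosen lattice subspaces with the finite-dimensional
  truncated continuum space `W` (playing `𝒱_{≤ h+N}`) and retractions `π_L` onto `S_L`, along which
  every matrix coefficient `φ (ι_L (P_L l_{L,n} P_L) ι_L⁻¹ w)` converges to `φ (Tₙ w)` (`Tₙ`
  playing `P Lₙ P`) for all `|n| ≤ N`, all `w ∈ W`, `φ ∈ W^*` — GSJS's statement 1);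
* `KooSaleurConvergence` — the full notion: lattice data `(V_L, H_L, l_{L,n})`, scaling-window
  parameters `(e_∞, f_s, v_s, h)`, and a filtered continuum target `(W_N, T_{N,n})_N`; convergence at
  every cutoff `N` with `S_L = scalingWindow H_L (L e_∞ + f_s + (π v_s / L)(h + N))` and `H_L`-
  equivariant retractions (Koo–Saleur's "representation of `P Vir P`" conjecture in this form).

No facts are asserted. The Virasoro structure of the target (the planned `VirasoroModuleC0`) is not
needed to STATE convergence and is deliberately not imported: a graded Virasoro module
`𝒱 = ⊕ₘ 𝒱_{h+m}` furnishes `W_N = ⊕_{m ≤ N} 𝒱_{h+m}`, `T_{N,n} = P Lₙ P`.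

## References

* [KooSaleur1994] W. M. Koo, H. Saleur, Nucl. Phys. B 426 (1994) 459–504, §3 (hep-th/9312156
  pp. 6–9).
* [GransSamuelssonLiuHeJacobsenSaleur2020] L. Grans-Samuelsson, L. Liu, Y. He, J. L. Jacobsen,
  H. Saleur, JHEP 10 (2020) 109 = arXiv:2007.11539, §4.3 eq. (generators), App. 10.1 (generic_swc).
* [GransSamuelssonJacobsenSaleur2021] L. Grans-Samuelsson, J. L. Jacobsen, H. Saleur, JHEP 02 (2021)
  130 = arXiv:2010.12819, §7.1.
* A. Milsted, G. Vidal, Phys. Rev. B 96 (2017) 245105 (open-chain lattice Virasoro modes).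
-/

noncomputable section

open Filter Topology Complex
open scoped Real

namespace Literature.MathematicalPhysics.StatisticalMechanics

/-! ### The Koo–Saleur generators (periodic chain, printed form) -/

section Generators

variable {V : Type*} [AddCommGroup V] [Module ℂ V] {N : ℕ}

/-- **The Koo–Saleur generator `ℒₙ[N]`** of a periodic chain of `N` sites with local
(Temperley–Lieb) densities `e : Fin N → End V` (the index `j + 1` is taken modulo `N`), anisotropy
`γ` (`q = e^{iγ}`), bulk energy density `e_∞` and central charge `c`:
`(N/4π)[-(γ/(π sin γ)) Σⱼ e^{2πin(j+1)/N} (eⱼ - e_∞ + (iγ/(π sin γ)) [eⱼ, e_{j+1}])] + (c/24) δ_{n,0}`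
(sites numbered `1, …, N` in print, whence the phase at `j + 1` for `j : Fin N`).
[cite: GransSamuelssonLiuHeJacobsenSaleur2020, §4.3 eq. (generators)] -/
def kooSaleurGen [NeZero N] (γ eInf c : ℂ) (e : Fin N → Module.End ℂ V) (n : ℤ) : Module.End ℂ V :=
  ((N : ℂ) / (4 * π)) •
      ((-γ / (π * Complex.sin γ)) •
        ∑ j : Fin N, Complex.exp (2 * π * I * n * ((j : ℕ) + 1 : ℂ) / N) •
          (e j - eInf • (1 : Module.End ℂ V) +
            (I * γ / (π * Complex.sin γ)) • (e j * e (j + 1) - e (j + 1) * e j))) +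
    (if n = 0 then (c / 24) • (1 : Module.End ℂ V) else 0)

/-- **The antichiral Koo–Saleur generator `ℒ̄ₙ[N]`** (conjugate phases, opposite sign of the
commutator term). [cite: GransSamuelssonLiuHeJacobsenSaleur2020, §4.3 eq. (generators)] -/
def kooSaleurGenBar [NeZero N] (γ eInf c : ℂ) (e : Fin N → Module.End ℂ V) (n : ℤ) : Module.End ℂ V :=
  ((N : ℂ) / (4 * π)) •
      ((-γ / (π * Complex.sin γ)) •
        ∑ j : Fin N, Complex.exp (-(2 * π * I * n * ((j : ℕ) + 1 : ℂ) / N)) •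
          (e j - eInf • (1 : Module.End ℂ V) -
            (I * γ / (π * Complex.sin γ)) • (e j * e (j + 1) - e (j + 1) * e j))) +
    (if n = 0 then (c / 24) • (1 : Module.End ℂ V) else 0)

/-- The generic lattice Fourier mode `Σⱼ (wⱼ • Aⱼ + w'ⱼ • Bⱼ)` of two families of local operators
(e.g. `Aⱼ = hⱼ - e_∞`, `Bⱼ = i[hⱼ, h_{j+1}]` with cosine / sine weights for an open chain), the
building block of every Koo–Saleur-type generator. [folklore] -/
def latticeMode {ι : Type*} [Fintype ι] (w w' : ι → ℂ) (A B : ι → Module.End ℂ V) : Module.End ℂ V :=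
  ∑ j, (w j • A j + w' j • B j)

/-- For `n ≠ 0` the Koo–Saleur generator has no central term. [folklore] -/
theorem kooSaleurGen_of_ne_zero [NeZero N] (γ eInf c : ℂ) (e : Fin N → Module.End ℂ V) {n : ℤ}
    (hn : n ≠ 0) :
    kooSaleurGen γ eInf c e n =
      ((N : ℂ) / (4 * π)) •
        ((-γ / (π * Complex.sin γ)) •
          ∑ j : Fin N, Complex.exp (2 * π * I * n * ((j : ℕ) + 1 : ℂ) / N) •
            (e j - eInf • (1 : Module.End ℂ V) +
              (I * γ / (π * Complex.sin γ)) • (e j * e (j + 1) - e (j + 1) * e j))) := by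
  simp [kooSaleurGen, hn]

end Generators

/-! ### Compressions, scaling windows -/

section Compress

variable {V : Type*} [AddCommGroup V] [Module ℂ V]

/-- The **compression** `P A P` of an endomorphism `A` to a subspace `S`, along a chosen linear
retraction `π : V → S` (for a sum of generalised eigenspaces of `H`, the spectral projection): the
endomorphism `π ∘ A ∘ incl` of `S`. [folklore] -/
def compress (S : Submodule ℂ V) (proj : V →ₗ[ℂ] S) (A : Module.End ℂ V) : Module.End ℂ S :=
  proj ∘ₗ A ∘ₗ S.subtype

/-- Unfolding lemma for `compress`. [folklore] -/
@[simp] theorem compress_apply (S : Submodule ℂ V) (proj : V →ₗ[ℂ] S) (A : Module.End ℂ V) (x : S) :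
    compress S proj A x = proj (A x) := rfl

/-- `π : V → S` is a **retraction onto** `S`: `π x = x` for `x ∈ S`. [folklore] -/
def IsRetractionOnto (S : Submodule ℂ V) (proj : V →ₗ[ℂ] S) : Prop :=
  ∀ x : S, proj x = x

/-- The retraction **commutes with** `H`: `π (H x) = (P H P)(π x)`-type equivariance, in the form
`π ∘ H = compress S π H ∘ π` (true for the spectral projection onto a sum of generalised eigenspaces
of `H` along the others). [folklore] -/
def CommutesWith (S : Submodule ℂ V) (proj : V →ₗ[ℂ] S) (H : Module.End ℂ V) : Prop :=
  ∀ x : V, proj (H x) = compress S proj H (proj x)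

/-- The **scaling window** of `H` below `Λ`: the sum of the generalised eigenspaces of `H` for the
eigenvalues `μ` with `Re μ ≤ Λ` — the span of the low-energy (generalised) eigenstates, i.e. the
lattice "scaling states" below a given scaled gap (GSJS 2021 §7.1: restriction to scaling states;
generalised eigenspaces because `H` need not be diagonalisable in the non-unitary setting). [folklore] -/
def scalingWindow (H : Module.End ℂ V) (Λ : ℝ) : Submodule ℂ V :=
  ⨆ (μ : ℂ) (_ : μ.re ≤ Λ), H.maxGenEigenspace μ

/-- Generalised eigenvectors with `Re μ ≤ Λ` lie in the scaling window. [folklore] -/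
theorem maxGenEigenspace_le_scalingWindow (H : Module.End ℂ V) {Λ : ℝ} {μ : ℂ} (hμ : μ.re ≤ Λ) :
    H.maxGenEigenspace μ ≤ scalingWindow H Λ :=
  le_iSup₂_of_le μ hμ le_rfl

/-- The scaling window is monotone in the cutoff. [folklore] -/
theorem scalingWindow_mono (H : Module.End ℂ V) {Λ Λ' : ℝ} (h : Λ ≤ Λ') :
    scalingWindow H Λ ≤ scalingWindow H Λ' :=
  iSup₂_le fun _ hμ => maxGenEigenspace_le_scalingWindow H (hμ.trans h)

end Compress

/-! ### Scaling-weak convergence -/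

section Convergence

variable (V : ℕ → Type*) [∀ L, AddCommGroup (V L)] [∀ L, Module ℂ (V L)]
variable {W : Type*} [AddCommGroup W] [Module ℂ W]

/-- **Scaling-weak convergence at a fixed cutoff** (Grans-Samuelsson–Jacobsen–Saleur 2021, §7.1,
statement 1): "matrix elements of lattice Virasoro generators converge, when evaluated between
scaling states, to their expected continuum limit"; 2020 paper App. 10.1 (generic_swc), projector of
fixed rank), in a basis-free and inner-product-free form. Data: lattice spaces `V L` with lattice
generators `l L n`, chosen subspaces of scaling states `S L ⊆ V L`, a finite-dimensional continuum
space `W` (playing `𝒱_{≤ h+N}`) with operators `T n` (playing `P Lₙ P`), and the mode cutoff `N`.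
Statement: there are `L₀`, retractions `π_L` onto `S_L` and linear identifications
`ι_L : S_L ≃ W` for `L ≥ L₀`, such that for every `|n| ≤ N`, `w ∈ W` and `φ ∈ W^*` the matrix
coefficient `φ (ι_L (P_L l_{L,n} P_L) ι_L⁻¹ w)` tends to `φ (Tₙ w)` as `L → ∞`.
[cite: GransSamuelssonJacobsenSaleur2021, §7.1] -/
def ConvergesScalingWeaklyAt (l : (L : ℕ) → ℤ → Module.End ℂ (V L))
    (S : (L : ℕ) → Submodule ℂ (V L)) (T : ℤ → Module.End ℂ W) (N : ℕ) : Prop :=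
  ∃ (L₀ : ℕ) (proj : (L : ℕ) → (V L →ₗ[ℂ] S L)) (ι : (L : ℕ) → L₀ ≤ L → (S L ≃ₗ[ℂ] W)),
    (∀ L, L₀ ≤ L → IsRetractionOnto (S L) (proj L)) ∧
      ∀ n : ℤ, n.natAbs ≤ N → ∀ (φ : Module.Dual ℂ W) (w : W),
        Tendsto (fun L => if h : L₀ ≤ L then
            φ (ι L h (compress (S L) (proj L) (l L n) ((ι L h).symm w))) else 0)
          atTop (𝓝 (φ (T n w)))

/-- **Koo–Saleur scaling-weak convergence of a critical chain to a filtered continuum target**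
(Koo–Saleur 1994 §3, "representation of `P Vir P`"; GSJS 2021 §7.1), the notion requested by the
route `CriticalPhenomena/SAWLatticeVirasoro`: lattice data `V L`, Hamiltonians `H L`, lattice
Virasoro generators `l L n` (e.g. `kooSaleurGen` or an open-chain `latticeMode`); scaling parameters
`e_∞` (bulk energy per site), `f_s` (surface energy), `v_s` (sound velocity), `h` (lowest weight);
continuum target: for each cutoff `N` a space `W N` (playing `𝒱_{≤ h+N}`) with operators `T N n`
(playing `P Lₙ P`). Statement: for every `N`, `ConvergesScalingWeaklyAt` holds with the scaling
windows `S_L = scalingWindow (H L) (L e_∞ + f_s + (π v_s / L)(h + N))` (generalised eigenstates of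
scaled gap `(L/π v_s)(E - L e_∞ - f_s) ≤ h + N`) and with `H_L`-equivariant retractions.
[cite: KooSaleur1994, §3] [cite: GransSamuelssonJacobsenSaleur2021, §7.1] -/
def KooSaleurConvergence (H : (L : ℕ) → Module.End ℂ (V L)) (l : (L : ℕ) → ℤ → Module.End ℂ (V L))
    (eInf fₛ vₛ h : ℝ)
    (W : ℕ → Type*) [∀ N, AddCommGroup (W N)] [∀ N, Module ℂ (W N)]
    (T : (N : ℕ) → ℤ → Module.End ℂ (W N)) : Prop :=
  ∀ N : ℕ,
    let S : (L : ℕ) → Submodule ℂ (V L) :=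
      fun L => scalingWindow (H L) (L * eInf + fₛ + π * vₛ / L * (h + N))
    ∃ (L₀ : ℕ) (proj : (L : ℕ) → (V L →ₗ[ℂ] S L)) (ι : (L : ℕ) → L₀ ≤ L → (S L ≃ₗ[ℂ] W N)),
      (∀ L, L₀ ≤ L → IsRetractionOnto (S L) (proj L) ∧ CommutesWith (S L) (proj L) (H L)) ∧
        ∀ n : ℤ, n.natAbs ≤ N → ∀ (φ : Module.Dual ℂ (W N)) (w : W N),
          Tendsto (fun L => if hL : L₀ ≤ L then
              φ (ι L hL (compress (S L) (proj L) (l L n) ((ι L hL).symm w))) else 0)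
            atTop (𝓝 (φ (T N n w)))

variable {V}

/-- `KooSaleurConvergence` implies scaling-weak convergence at every cutoff on the scaling windows
(forget the `H_L`-equivariance of the retractions). [folklore] -/
theorem KooSaleurConvergence.convergesScalingWeaklyAt
    {H : (L : ℕ) → Module.End ℂ (V L)} {l : (L : ℕ) → ℤ → Module.End ℂ (V L)} {eInf fₛ vₛ h : ℝ}
    {W : ℕ → Type*} [∀ N, AddCommGroup (W N)] [∀ N, Module ℂ (W N)]
    {T : (N : ℕ) → ℤ → Module.End ℂ (W N)}
    (hc : KooSaleurConvergence V H l eInf fₛ vₛ h W T) (N : ℕ) :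
    ConvergesScalingWeaklyAt V l
      (fun L => scalingWindow (H L) (L * eInf + fₛ + π * vₛ / L * (h + N))) (T N) N := by
  obtain ⟨L₀, proj, ι, hproj, hconv⟩ := hc N
  exact ⟨L₀, proj, ι, fun L hL => (hproj L hL).1, hconv⟩

/-- A trivially convergent instance (non-vacuity of the shape): zero lattice generators on the zero
spaces converge to the zero operators on the zero target. [folklore] -/
theorem convergesScalingWeaklyAt_zero (N : ℕ) :
    ConvergesScalingWeaklyAt (fun _ : ℕ => PUnit) (fun _ _ => 0) (fun _ => ⊤)
      (W := PUnit) (fun _ => 0) N := by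
  refine ⟨0, fun _ => 0, fun _ _ => ?_, fun _ _ x => Subsingleton.elim _ _, ?_⟩
  · exact { toFun := fun _ => PUnit.unit, map_add' := fun _ _ => rfl, map_smul' := fun _ _ => rfl,
            invFun := fun _ => ⟨PUnit.unit, trivial⟩, left_inv := fun x => Subsingleton.elim _ _,
            right_inv := fun x => Subsingleton.elim _ _ }
  · intro n _ φ w
    have : ∀ x : PUnit, φ x = 0 := fun x => by
      rw [Subsingleton.elim x 0, map_zero]
    simp only [this, dif_pos (Nat.zero_le _)]
    exact tendsto_const_nhds

end Convergence

end Literature.MathematicalPhysics.StatisticalMechanics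

end
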